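import Literature.AlgebraicGeometry.Motives.HodgeLieWeightOneRankEightSymplectic
import Literature.AlgebraicGeometry.Motives.HodgeLieWeightOnePlusPairTwinParity
import Literature.AlgebraicGeometry.Motives.HodgeLieWeightOnePlusLineCommutant
import Literature.Algebra.Lie.SemisimpleDimensionThreeSimple
import HarnessLib

/-!
# The normal form of the MUMFORD POSITION in rank eight: `Lie Hg ⊗ ℂ = 𝔰 ⊕ W ⊕ W'`, three commuting `𝔰𝔩₂`'s,
# each acting on `V_ℂ` through copies of the standard representation (so `V_ℂ ≅ 2 ⊠ 2 ⊠ 2`)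
# (Moonen–Zarhin 1999 Thm. (0.1)(3), §2 (2.5)(1); Moonen–Zarhin 1995 §2 type I(1); Mumford 1969 §4)

Topic `Literature/AlgebraicGeometry/Motives` (namespace `Literature.AlgebraicGeometry.Motives.HodgeStructure`).  Theorems only
(no definition, no named fact; D-0026).  Written for the cell `pub-hodge-ring2` (literature lane gen 73, programme R50 «`B•(X) =
D•(X)` for the `End⁰ = ℚ` fourfolds in the Mumford position»; honest framing of that cell: research route conditional on HC_CM;
not a corollary; Q11.4-sentence-2 already refuted in dim ≥ 3 — THIS file is unconditional Hodge–Lie theory).  Sequel of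
`HodgeLieWeightOneRankEightSymplectic` (`hodgeLieC_rankEight_dichotomy`: for a polarized weight-one Hodge structure of rank `8`
with `End_Hdg = ℚ`, EITHER `Lie Hg ⊗ ℂ ∋` every `ψ_ℂ`-skew operator, OR the MUMFORD POSITION — a plus pair `B₀`, `C₀ = B̄₀`
spanning the raising/lowering lines, `B₀C₀ = μ₀ ≠ 0` on `V^{1,0}`, and `Lie Hg ⊗ ℂ = W ⊕ C` with a three-dimensional ideal `W`
commuting with `C` and with `𝔰 = ⟨B₀, C₀, Θ⟩`).  MZ99 print the second branch as «`Hg(X)` is a `ℚ`-form of an almost direct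
product of three copies of `SL₂`» [corpus `paper:arxiv-math_9901113` p. 5 L142–148], after MZ95 §2, where `V_ℂ` is the tensor
product of the three standard representations (Mumford 1969 §4).  This file PROVES that normal form from the Mumford-position
data, CLASSIFICATION-FREE:

* §1 `MumfordNF.sTriple` — the `𝔰`-triple `(Θ, B₀, μ₀⁻¹ C₀)` is an `𝔰𝔩₂`-triple of operators in STANDARD FORM (`Θ² = 1`,
  `B₀² = 0`, `B₀ (μ₀⁻¹C₀) = ½(1 + Θ)`, …): `V_ℂ ≅ std ⊗ V^{1,0}` for `𝔰`.
* §2 **`MumfordNF.standardForm_of_twin`** (any rank) — a three-dimensional ideal `W₁` of `𝔥_ℂ = Lie Hg ⊗ ℂ` with a commuting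
  complement, spanned by an `𝔰𝔩₂`-triple `(h, e, f)` (`exists_sl2Triple_of_twin`), acts on `V_ℂ` through copies of the STANDARD
  representation when `End_Hdg(V) = ℚ`: the Casimir `4fe + h² + 2h` commutes with `𝔥_ℂ`, so it is a scalar `c`
  (`mem_span_endAlg_of_forall_commute`), and `c · d = tr(4fe + h² + 2h) = 2d + d` by the Galois-swap identity
  `8 tr(xy) = d κ(x, y)` (`eight_mul_trace_mul_eq_finrank_mul_killingForm_of_plusPair`) with `κ(h, h) = 8`
  (`killingForm_eq_eight_of_twin`), `κ(e, f) = ½ κ(h, h)` (invariance); then `Sl2.weightOne_of_casimir_eq_three`.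
* §3 **`MumfordNF.exists_third_ideal`** (rank `8`) — the centraliser `W'` of `𝔰` in `C` is a THIRD three-dimensional ideal and
  `𝔥_ℂ = 𝔰 ⊕ W ⊕ W'`: `𝔥_ℂ = 𝔰 ⊕ Z_{𝔥_ℂ}(𝔰)` (the `ad Θ`-grading and the raising/lowering lines), `Z_{𝔥_ℂ}(𝔰) = W ⊕ W'`;
  `dim W' ≤ 3` because `W' ⊕ ℂ·1` lies in the joint commutant of the two standard triples of `𝔰` and `W`, of dimension
  `(rk P′P)² = (d/4)² = 4` (`SL2TriplePairCommutant.finrank_pairCommutant_eq_sq`, `four_mul_finrank_range_eq`); `dim W' ≥ 3`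
  because `W' ≠ 0` (else that commutant would be `End_Hdg ⊗ ℂ = ℂ`) and a non-zero ideal of the semisimple `𝔥_ℂ`
  (`isKilling_of_plusLine`) contains an atom, of dimension `≥ 3` (`three_le_finrank_of_isAtom`).
* §4 **`exists_mumford_normalForm`** — THE NORMAL FORM: three pairwise commuting `𝔰𝔩₂`-triples of operators
  `(H_i, E_i, F_i)_{i=0,1,2}` in `𝔥_ℂ`, `(H₀, E₀, F₀) = (Θ, B₀, μ₀⁻¹C₀)`, each in standard form on `V_ℂ`, spanning `𝔥_ℂ`
  (so `dim_ℂ 𝔥_ℂ = 9`: «a `ℚ`-form of `SL₂ × SL₂ × SL₂`»).  The product basis `V_ℂ ≅ 2 ⊠ 2 ⊠ 2` is drawn in the sequel.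

## References

* [MoonenZarhin1999LowDim] B. Moonen, Yu. Zarhin, Math. Ann. 315 (1999), Thm. (0.1)(3); §2 (2.3), (2.5)(1)
  [corpus: paper:arxiv-math_9901113 p0001 L112–118, p0005 L142–148].
* [MoonenZarhin1995Duke] B. Moonen, Yu. Zarhin, Duke Math. J. 77 (1995), §2 and main theorem, type I(1) [acq-04933 cite-only].
* [Mumford1969NoteShimura] D. Mumford, *A note of Shimura's paper …*, Math. Ann. 181 (1969), §4.
* [Deligne1982HodgeCycles] P. Deligne, *Hodge cycles on abelian varieties*, LNM 900 (1982), I §3 Prop. 3.4, 3.6.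
* [Jacobson1962LieAlgebras] N. Jacobson, *Lie Algebras* (1962), Ch. III §8, Ch. X §1.
* [FultonHarris1991] W. Fulton, J. Harris, GTM 129 (1991), Lecture 11 (§11.1).
* [Humphreys1972] J. E. Humphreys, GTM 9 (1972), §6.2, §7.2, §8.3.
-/

open scoped TensorProduct

namespace Literature.AlgebraicGeometry.Motives

open Module
open Literature.Algebra.Lie
open Literature.RepresentationTheory.GeneralLinear

universe u

variable {V : Type u} [AddCommGroup V] [Module ℚ V] [Module.Finite ℚ V] [HodgeTensorFacts.{u, u}] {n : ℤ}

namespace HodgeStructure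

/-! ## §1 The `𝔰`-triple `(Θ, B₀, μ₀⁻¹ C₀)` is standard -/

omit [Module.Finite ℚ V] [HodgeTensorFacts.{u, u}] in
/-- **The `𝔰`-triple is an `𝔰𝔩₂`-triple of operators in standard form.**  With `P = ½(1 + Θ)` (the projector onto
`V^{1,0}` along `V^{0,1}`): `Θ² = 1`, `B₀² = C₀² = 0`, `P² = P`, `P B₀ = B₀`, `B₀ P = 0`, `P C₀ = 0`, `C₀ P = C₀`, `B₀ C₀ = μ₀ P`,
`C₀ B₀ = μ₀ (1 − P)`, `Θ B₀ = B₀ = −B₀ Θ`, `Θ C₀ = −C₀ = −C₀ Θ`, `Θ P = P Θ`, `B₀ C₀ − C₀ B₀ = μ₀ Θ` — all checked on `V^{1,0}`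
and `V^{0,1}`.  (`V_ℂ ≅ std ⊗ V^{1,0}` for `𝔰 = ⟨B₀, C₀, Θ⟩ ≅ 𝔰𝔩₂`, Fulton–Harris §11.1.)
[cite: Deligne1982HodgeCycles, I §3 Example 3.7] [cite: FultonHarris1991, Lecture 11 (§11.1)] -/
theorem MumfordNF.sTriple (H : HodgeStructure V n) (hn : n = 1) (heff : H.IsEffective)
    {Θ : Module.End ℂ (ℂ ⊗[ℚ] V)} (hΘ : ∀ p, ∀ x ∈ H.piece p (n - p), Θ x = ((2 * p - n : ℤ) : ℂ) • x)
    {B₀ C₀ : Module.End ℂ (ℂ ⊗[ℚ] V)} (hB₀P : ∀ p ∈ H.piece 1 0, B₀ p = 0) (hB₀im : ∀ v, B₀ v ∈ H.piece 1 0)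
    (hC₀ : ∀ v, C₀ v = conj (B₀ (conj v))) {μ₀ : ℂ}
    (hBC : ∀ p ∈ H.piece 1 0, B₀ (C₀ p) = μ₀ • p) (hCB : ∀ q ∈ H.piece 0 1, C₀ (B₀ q) = μ₀ • q) :
    Θ * Θ = 1 ∧ B₀ * B₀ = 0 ∧ C₀ * C₀ = 0 ∧
    ((2 : ℂ)⁻¹ • (1 + Θ)) * ((2 : ℂ)⁻¹ • (1 + Θ)) = (2 : ℂ)⁻¹ • (1 + Θ) ∧
    ((2 : ℂ)⁻¹ • (1 + Θ)) * B₀ = B₀ ∧ B₀ * ((2 : ℂ)⁻¹ • (1 + Θ)) = 0 ∧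
    ((2 : ℂ)⁻¹ • (1 + Θ)) * C₀ = 0 ∧ C₀ * ((2 : ℂ)⁻¹ • (1 + Θ)) = C₀ ∧
    B₀ * C₀ = μ₀ • ((2 : ℂ)⁻¹ • (1 + Θ)) ∧ C₀ * B₀ = μ₀ • (1 - (2 : ℂ)⁻¹ • (1 + Θ)) ∧
    Θ * B₀ = B₀ ∧ B₀ * Θ = -B₀ ∧ Θ * C₀ = -C₀ ∧ C₀ * Θ = C₀ ∧
    Θ * ((2 : ℂ)⁻¹ • (1 + Θ)) = ((2 : ℂ)⁻¹ • (1 + Θ)) * Θ ∧ B₀ * C₀ - C₀ * B₀ = μ₀ • Θ := by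
  obtain ⟨hC₀Q, hC₀im, hcomm, -, -, hext⟩ := PlusPairTwin.facts H hn heff hΘ hB₀P hB₀im hC₀ hBC hCB
  subst hn
  obtain ⟨hPmem, hQmem, hΘ10, hΘ01, hΘΘ⟩ := UnitaryTheta.theta_facts H rfl heff hΘ
  have hPp : ∀ p ∈ H.piece 1 0, ((2 : ℂ)⁻¹ • (1 + Θ)) p = p := fun p hp => by
    rw [LinearMap.smul_apply, LinearMap.add_apply, Module.End.one_apply, hΘ10 p hp]; module
  have hPq : ∀ q ∈ H.piece 0 1, ((2 : ℂ)⁻¹ • (1 + Θ)) q = 0 := fun q hq => by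
    rw [LinearMap.smul_apply, LinearMap.add_apply, Module.End.one_apply, hΘ01 q hq, add_neg_cancel, smul_zero]
  have hB₀B₀ : ∀ v, B₀ (B₀ v) = 0 := fun v => hB₀P _ (hB₀im v)
  have hC₀C₀ : ∀ v, C₀ (C₀ v) = 0 := fun v => hC₀Q _ (hC₀im v)
  refine ⟨?_, ?_, ?_, ?_, ?_, ?_, ?_, ?_, ?_, ?_, ?_, ?_, ?_, ?_, ?_, hcomm⟩
  · exact LinearMap.ext fun v => by rw [Module.End.mul_apply, hΘΘ, Module.End.one_apply]
  · exact LinearMap.ext fun v => by rw [Module.End.mul_apply, hB₀B₀, LinearMap.zero_apply]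
  · exact LinearMap.ext fun v => by rw [Module.End.mul_apply, hC₀C₀, LinearMap.zero_apply]
  · exact hext _ _ (fun p hp => by rw [Module.End.mul_apply, hPp p hp, hPp p hp])
      (fun q hq => by rw [Module.End.mul_apply, hPq q hq, map_zero])
  · exact LinearMap.ext fun v => by rw [Module.End.mul_apply, hPp _ (hB₀im v)]
  · exact hext _ _ (fun p hp => by rw [Module.End.mul_apply, hPp p hp, hB₀P p hp, LinearMap.zero_apply])
      (fun q hq => by rw [Module.End.mul_apply, hPq q hq, map_zero, LinearMap.zero_apply])
  · exact LinearMap.ext fun v => by rw [Module.End.mul_apply, hPq _ (hC₀im v), LinearMap.zero_apply]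
  · exact hext _ _ (fun p hp => by rw [Module.End.mul_apply, hPp p hp])
      (fun q hq => by rw [Module.End.mul_apply, hPq q hq, map_zero, hC₀Q q hq])
  · exact hext _ _ (fun p hp => by rw [Module.End.mul_apply, hBC p hp, LinearMap.smul_apply, hPp p hp])
      (fun q hq => by rw [Module.End.mul_apply, hC₀Q q hq, map_zero, LinearMap.smul_apply, hPq q hq, smul_zero])
  · exact hext _ _
      (fun p hp => by
        rw [Module.End.mul_apply, hB₀P p hp, map_zero, LinearMap.smul_apply, LinearMap.sub_apply,
          Module.End.one_apply, hPp p hp, sub_self, smul_zero])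
      (fun q hq => by
        rw [Module.End.mul_apply, hCB q hq, LinearMap.smul_apply, LinearMap.sub_apply, Module.End.one_apply, hPq q hq,
          sub_zero])
  · exact LinearMap.ext fun v => by rw [Module.End.mul_apply, hΘ10 _ (hB₀im v)]
  · exact hext _ _ (fun p hp => by rw [Module.End.mul_apply, hΘ10 p hp, hB₀P p hp, LinearMap.neg_apply, hB₀P p hp, neg_zero])
      (fun q hq => by rw [Module.End.mul_apply, hΘ01 q hq, map_neg, LinearMap.neg_apply])
  · exact LinearMap.ext fun v => by rw [Module.End.mul_apply, hΘ01 _ (hC₀im v), LinearMap.neg_apply]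
  · exact hext _ _ (fun p hp => by rw [Module.End.mul_apply, hΘ10 p hp])
      (fun q hq => by rw [Module.End.mul_apply, hΘ01 q hq, map_neg, hC₀Q q hq, neg_zero])
  · rw [mul_smul_comm, smul_mul_assoc, mul_add, add_mul, mul_one, one_mul]

/-! ## §2 A twin ideal acts through copies of the standard representation (`End_Hdg = ℚ`, any rank) -/

omit [HodgeTensorFacts.{u, u}] in
/-- An operator commuting with `h`, `e`, `f` commutes with their Casimir `4fe + h² + 2h`. [cite: Humphreys1972, §6.2] -/
theorem MumfordNF.casimir_comm_of_comm {M : Type*} [AddCommGroup M] [Module ℂ M] {h e f c : Module.End ℂ M}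
    (hh : h * c = c * h) (he : e * c = c * e) (hf : f * c = c * f) :
    Sl2.casimir h e f * c = c * Sl2.casimir h e f := by
  have t1 : f * e * c = c * (f * e) := by rw [mul_assoc, he, ← mul_assoc, hf, mul_assoc]
  have t2 : h * h * c = c * (h * h) := by rw [mul_assoc, hh, ← mul_assoc, hh, mul_assoc]
  simp only [Sl2.casimir, add_mul, mul_add, smul_mul_assoc, mul_smul_comm, t1, t2, hh]

set_option maxHeartbeats 800000 in
/-- **A three-dimensional twin ideal of `𝔥_ℂ` acts on `V_ℂ` through copies of the standard representation** (any rank,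
`End_Hdg(V) = ℚ`).  In the plus-pair position let `𝔥_ℂ = W ⊕ C`, `[W, C] = 0`, `dim W = 3`, `W` `ad`-stable and spanned by an
`𝔰𝔩₂`-triple of operators `(h, e, f)` (`exists_sl2Triple_of_twin`).  Then `h² = 1`, `e² = f² = 0`, `ef = ½(1 + h)`,
`fe = ½(1 − h)`, `he = e = −eh`, `hf = −f = −fh`.  PROOF: the Casimir `𝒞 = 4fe + h² + 2h` commutes with `h, e, f`
(`Sl2CasimirCommute`) and with `C`, hence with `𝔥_ℂ`, so `𝒞 ∈ End_Hdg ⊗ ℂ = ℂ · 1` (`mem_span_endAlg_of_forall_commute`), say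
`𝒞 = c`; by the Galois-swap identity `8 tr_{V_ℂ}(xy) = d κ(x, y)` on `𝔥_ℂ` (`eight_mul_trace_mul_eq_finrank_mul_killingForm_of_plusPair`,
`d = dim_ℚ V`) and `κ(h, h) = 8` (`killingForm_eq_eight_of_twin`), `κ(e, f) = ½ κ([e, f], h) = 4` (invariance), one gets
`tr(h²) = d`, `tr(fe) = tr(ef) = d/2`, `tr h = tr [e, f] = 0`, so `c d = tr 𝒞 = 3d` and `𝒞 = 3`; conclude by
`Sl2.weightOne_of_casimir_eq_three` (a finite-dimensional module on which the Casimir is `3 = 1·(1+2)` is a sum of copies of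
`V(1)`).  Moonen–Zarhin (2.3)/(2.5)(1): the simple factors of `Hg_ℂ` act on `V_ℂ` through their standard representations
(«`ℚ`-form of `SL₂ × SL₂ × SL₂`», `V_ℂ` the tensor product of the standard representations).
[cite: MoonenZarhin1999LowDim, §2 (2.3) and (2.5)(1)] [cite: Mumford1969NoteShimura, §4] [cite: Humphreys1972, §7.2 and §8.3]
[cite: FultonHarris1991, Lecture 11 (§11.1)] -/
theorem MumfordNF.standardForm_of_twin (H : HodgeStructure V n) (ψ : H.Polarization) (hn : n = 1)
    (heff : H.IsEffective) {Θ : Module.End ℂ (ℂ ⊗[ℚ] V)}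
    (hΘ : ∀ p, ∀ x ∈ H.piece p (n - p), Θ x = ((2 * p - n : ℤ) : ℂ) • x)
    {B₀ C₀ : Module.End ℂ (ℂ ⊗[ℚ] V)} (hB₀ : B₀ ∈ H.hodgeLieC) (hB₀0 : B₀ ≠ 0)
    (hB₀P : ∀ p ∈ H.piece 1 0, B₀ p = 0) (hB₀im : ∀ v, B₀ v ∈ H.piece 1 0)
    (hC₀ : ∀ v, C₀ v = conj (B₀ (conj v))) {μ₀ : ℂ} (hμ₀ : μ₀ ≠ 0)
    (hBC : ∀ p ∈ H.piece 1 0, B₀ (C₀ p) = μ₀ • p) (hCB : ∀ q ∈ H.piece 0 1, C₀ (B₀ q) = μ₀ • q)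
    (hline : ∀ B ∈ H.hodgeLieC, (∀ p ∈ H.piece 1 0, B p = 0) → (∀ v, B v ∈ H.piece 1 0) → ∃ c : ℂ, B = c • B₀)
    (hline' : ∀ C ∈ H.hodgeLieC, (∀ q ∈ H.piece 0 1, C q = 0) → (∀ v, C v ∈ H.piece 0 1) → ∃ c : ℂ, C = c • C₀)
    (hE : ∀ a ∈ H.endAlg, ∃ x : ℚ, a = x • (1 : Module.End ℚ V))
    {W C : Submodule ℂ (Module.End ℂ (ℂ ⊗[ℚ] V))} (hWle : W ≤ H.hodgeLieC)
    (hWC : W ⊔ C = H.hodgeLieC) (hW3 : Module.finrank ℂ W = 3)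
    (hcommWC : ∀ w ∈ W, ∀ c ∈ C, w * c = c * w)
    {h e f : Module.End ℂ (ℂ ⊗[ℚ] V)} (hh : h ∈ W) (he : e ∈ W) (hf : f ∈ W)
    (hHE : h * e - e * h = (2 : ℂ) • e) (hHF : h * f - f * h = -((2 : ℂ) • f)) (hEF : e * f - f * e = h)
    (hspan : ∀ w ∈ W, ∃ a b c : ℂ, w = a • h + b • e + c • f) :
    h * h = 1 ∧ e * e = 0 ∧ f * f = 0 ∧ e * f = (2 : ℂ)⁻¹ • (1 + h) ∧ f * e = (2 : ℂ)⁻¹ • (1 - h) ∧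
      h * e = e ∧ e * h = -e ∧ h * f = -f ∧ f * h = f := by
  classical
  letI iC : LieRing (Module.End ℂ (ℂ ⊗[ℚ] V)) := LieRing.ofAssociativeRing
  have hz := hodgeLie_inf_endAlg_eq_bot_of_forall_endAlg_eq_smul H ψ hE
  obtain ⟨𝔏', h𝔏'⟩ := exists_lieSubalgebra_eq_hodgeLieC H
  have hmem𝔏' : ∀ {x}, x ∈ 𝔏' ↔ x ∈ H.hodgeLieC := fun {x} => by rw [← LieSubalgebra.mem_toSubmodule, h𝔏']
  haveI : Module.Finite ℂ 𝔏' := Module.Finite.of_injective 𝔏'.toSubmodule.subtype Subtype.val_injective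
  have hkill := eight_mul_trace_mul_eq_finrank_mul_killingForm_of_plusPair H ψ hn heff hΘ hB₀ hB₀0 hB₀P hB₀im hC₀ hμ₀
    hBC hCB hline hline' hz 𝔏' h𝔏'
  -- `d = dim_ℚ V ≠ 0`
  have hd : (Module.finrank ℚ V : ℂ) ≠ 0 := by
    have hpos : 0 < Module.finrank ℂ (ℂ ⊗[ℚ] V) := by
      rw [Module.finrank_pos_iff]
      by_contra hnt
      rw [not_nontrivial_iff_subsingleton] at hnt
      exact hB₀0 (Subsingleton.elim _ _)
    rw [Module.finrank_baseChange] at hpos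
    exact_mod_cast hpos.ne'
  -- the triple as elements of `𝔏'`; `κ(h, h) = 8`, `κ(e, f) = 4`
  have hh𝔏 : h ∈ 𝔏' := hmem𝔏'.2 (hWle hh)
  have he𝔏 : e ∈ 𝔏' := hmem𝔏'.2 (hWle he)
  have hf𝔏 : f ∈ 𝔏' := hmem𝔏'.2 (hWle hf)
  have hWC' : W ⊔ C = 𝔏'.toSubmodule := by rw [h𝔏', hWC]
  have hκhh : killingForm ℂ 𝔏' ⟨h, hh𝔏⟩ ⟨h, hh𝔏⟩ = 8 :=
    killingForm_eq_eight_of_twin 𝔏' hWC' hcommWC hh he hf hHE hHF hspan hW3 hh𝔏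
  have hxy : ⁅(⟨e, he𝔏⟩ : 𝔏'), (⟨f, hf𝔏⟩ : 𝔏')⁆ = ⟨h, hh𝔏⟩ := Subtype.ext (by
    rw [LieSubalgebra.coe_bracket, LieRing.of_associative_ring_bracket]; exact hEF)
  have hyz : ⁅(⟨f, hf𝔏⟩ : 𝔏'), (⟨h, hh𝔏⟩ : 𝔏')⁆ = (2 : ℂ) • (⟨f, hf𝔏⟩ : 𝔏') := Subtype.ext (by
    rw [LieSubalgebra.coe_bracket, LieRing.of_associative_ring_bracket, SetLike.val_smul, ← neg_sub, hHF, neg_neg])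
  have hκef : killingForm ℂ 𝔏' ⟨e, he𝔏⟩ ⟨f, hf𝔏⟩ = 4 := by
    have h1 := LieModule.traceForm_apply_lie_apply ℂ 𝔏' 𝔏' (⟨e, he𝔏⟩ : 𝔏') ⟨f, hf𝔏⟩ ⟨h, hh𝔏⟩
    rw [hxy, hyz, map_smul, smul_eq_mul] at h1
    change killingForm ℂ 𝔏' ⟨h, hh𝔏⟩ ⟨h, hh𝔏⟩ = 2 * killingForm ℂ 𝔏' ⟨e, he𝔏⟩ ⟨f, hf𝔏⟩ at h1
    rw [hκhh] at h1
    linear_combination (-(1 : ℂ) / 2) * h1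
  -- traces: `tr(h²) = d`, `tr(ef) = tr(fe) = d/2`, `tr h = 0`
  have htr_hh : LinearMap.trace ℂ (ℂ ⊗[ℚ] V) (h * h) = (Module.finrank ℚ V : ℂ) := by
    have h8 := hkill ⟨h, hh𝔏⟩ ⟨h, hh𝔏⟩
    rw [hκhh] at h8
    have h8' : (8 : ℂ) * LinearMap.trace ℂ (ℂ ⊗[ℚ] V) (h * h) = 8 * (Module.finrank ℚ V : ℂ) := by
      rw [mul_comm (8 : ℂ) (Module.finrank ℚ V : ℂ)]; exact h8
    exact mul_left_cancel₀ (by norm_num : (8 : ℂ) ≠ 0) h8'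
  have htr_ef : LinearMap.trace ℂ (ℂ ⊗[ℚ] V) (e * f) = (2 : ℂ)⁻¹ * (Module.finrank ℚ V : ℂ) := by
    have h8 := hkill ⟨e, he𝔏⟩ ⟨f, hf𝔏⟩
    rw [hκef] at h8
    have h8' : (8 : ℂ) * LinearMap.trace ℂ (ℂ ⊗[ℚ] V) (e * f) = 8 * ((2 : ℂ)⁻¹ * (Module.finrank ℚ V : ℂ)) := by
      rw [show (8 : ℂ) * ((2 : ℂ)⁻¹ * (Module.finrank ℚ V : ℂ)) = (Module.finrank ℚ V : ℂ) * 4 by ring]; exact h8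
    exact mul_left_cancel₀ (by norm_num : (8 : ℂ) ≠ 0) h8'
  have htr_fe : LinearMap.trace ℂ (ℂ ⊗[ℚ] V) (f * e) = (2 : ℂ)⁻¹ * (Module.finrank ℚ V : ℂ) := by
    rw [LinearMap.trace_mul_comm, htr_ef]
  have htr_h : LinearMap.trace ℂ (ℂ ⊗[ℚ] V) h = 0 := by
    rw [← hEF, map_sub, LinearMap.trace_mul_comm, sub_self]
  -- the relations in the form of `Sl2StandardIsotypic`
  have hHE' : h * e = e * h + (2 : ℂ) • e := by rw [← hHE]; abel
  have hHF' : h * f = f * h - (2 : ℂ) • f := by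
    have h1 : h * f = (h * f - f * h) + f * h := by abel
    rw [h1, hHF]; abel
  have hEF' : e * f = f * e + h := by rw [← hEF]; abel
  -- the Casimir commutes with `𝔥_ℂ`
  set Cas := Sl2.casimir h e f with hCas
  have hCasW : ∀ w ∈ W, Cas * w = w * Cas := fun w hw => by
    obtain ⟨a, b, c, rfl⟩ := hspan w hw
    rw [mul_add, mul_add, add_mul, add_mul, mul_smul_comm, mul_smul_comm, mul_smul_comm, smul_mul_assoc, smul_mul_assoc,
      smul_mul_assoc, hCas, Sl2.casimir_mul_H hHE' hHF', Sl2.casimir_mul_E hHE' hEF', Sl2.casimir_mul_F hHF' hEF']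
  have hCasC : ∀ c ∈ C, Cas * c = c * Cas := fun c hc =>
    MumfordNF.casimir_comm_of_comm (hcommWC h hh c hc) (hcommWC e he c hc) (hcommWC f hf c hc)
  have hCascomm : ∀ X ∈ H.hodgeLie, Cas * X.baseChange ℂ = X.baseChange ℂ * Cas := fun X hX => by
    have hXC : X.baseChange ℂ ∈ W ⊔ C := by rw [hWC]; exact H.baseChange_mem_hodgeLieC hX
    obtain ⟨w, hw, c, hc, hwc⟩ := Submodule.mem_sup.1 hXC
    rw [← hwc, mul_add, add_mul, hCasW w hw, hCasC c hc]
  -- so it is a scalar `c`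
  have hCasspan := mem_span_endAlg_of_forall_commute H hCascomm
  have hle1 : Submodule.span ℂ ((fun a : Module.End ℚ V => a.baseChange ℂ) '' (H.endAlg : Set (Module.End ℚ V))) ≤
      Submodule.span ℂ {(1 : Module.End ℂ (ℂ ⊗[ℚ] V))} := by
    rw [Submodule.span_le]
    rintro _ ⟨a, ha, rfl⟩
    obtain ⟨x, rfl⟩ := hE a ha
    change (x • (1 : Module.End ℚ V)).baseChange ℂ ∈ Submodule.span ℂ {(1 : Module.End ℂ (ℂ ⊗[ℚ] V))}
    rw [LinearMap.baseChange_smul, LinearMap.baseChange_one]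
    exact Submodule.smul_of_tower_mem _ x (Submodule.subset_span rfl)
  obtain ⟨c, hc⟩ := Submodule.mem_span_singleton.1 (hle1 hCasspan)
  -- `c d = tr 𝒞 = 3 d`
  have htrCas : LinearMap.trace ℂ (ℂ ⊗[ℚ] V) Cas = 3 * (Module.finrank ℚ V : ℂ) := by
    rw [hCas, Sl2.casimir, map_add, map_add, map_smul, map_smul, htr_fe, htr_hh, htr_h, smul_eq_mul, smul_eq_mul]
    ring
  have htr1 : LinearMap.trace ℂ (ℂ ⊗[ℚ] V) (c • (1 : Module.End ℂ (ℂ ⊗[ℚ] V))) = c * (Module.finrank ℚ V : ℂ) := by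
    rw [map_smul, LinearMap.trace_one, Module.finrank_baseChange, smul_eq_mul]
  have hc3 : c = 3 := by
    rw [hc, htrCas] at htr1
    exact (mul_right_cancel₀ hd htr1).symm
  have hCas3 : Sl2.casimir h e f = (3 : ℂ) • (1 : Module.End ℂ (ℂ ⊗[ℚ] V)) := by rw [← hCas, ← hc, hc3]
  exact Sl2.weightOne_of_casimir_eq_three hHE' hHF' hEF' hCas3

/-! ## §3 The centraliser of `𝔰`: `𝔥_ℂ = 𝔰 + Z_{𝔥_ℂ}(𝔰)`, and the third ideal `W' = C ∩ Z_{𝔥_ℂ}(𝔰)` -/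

omit [Module.Finite ℚ V] [HodgeTensorFacts.{u, u}] in
/-- An operator commuting with `B₀`, `C₀`, `Θ` commutes with all of `𝔰 = ⟨B₀, C₀, Θ⟩_ℂ`. [folklore] -/
private theorem MumfordNF.commute_span_of_commute {Θ B₀ C₀ T : Module.End ℂ (ℂ ⊗[ℚ] V)} (hT : T * Θ = Θ * T)
    (hB : T * B₀ = B₀ * T) (hC : T * C₀ = C₀ * T) :
    ∀ s ∈ Submodule.span ℂ (Set.range ![B₀, C₀, Θ]), T * s = s * T := by
  intro s hs
  induction hs using Submodule.span_induction with
  | mem x hx =>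
    obtain ⟨i, rfl⟩ := hx
    fin_cases i
    · exact hB
    · exact hC
    · exact hT
  | zero => rw [mul_zero, zero_mul]
  | add x y _ _ hx hy => rw [mul_add, add_mul, hx, hy]
  | smul c x _ hx => rw [mul_smul_comm, smul_mul_assoc, hx]

set_option maxHeartbeats 800000 in
/-- **`𝔥_ℂ = 𝔰 + Z_{𝔥_ℂ}(𝔰)`**: in the plus-pair position every `Y ∈ 𝔥_ℂ` is `a B₀ + b C₀ + c Θ + Y'` with `Y' ∈ 𝔥_ℂ`
commuting with `Θ`, `B₀`, `C₀`.  PROOF: `Y = Y₋ + Y₀ + Y₊` for the `ad Θ`-grading (`SymplecticTheta.exists_decomp`), `Y₊ = aB₀`,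
`Y₋ = bC₀` (the raising/lowering lines); `[Y₀, B₀]` is raising, `= λ B₀`, and `Y' = Y₀ − (λ/2) Θ` commutes with `Θ` and `B₀`;
`[Y', C₀]` is lowering, `= λ' C₀`, and the Jacobi identity `[Y', [B₀, C₀]] = [B₀, [Y', C₀]]` reads `0 = λ' μ₀ Θ`, so `λ' = 0`.
(The centraliser of the ideal `𝔰 ≅ 𝔰𝔩₂` is a complementary ideal; Humphreys §5.2.) [cite: Humphreys1972, §5.2]
[cite: MoonenZarhin1999LowDim, §2 (2.3)] -/
theorem MumfordNF.exists_decomp (H : HodgeStructure V n) (hn : n = 1) (heff : H.IsEffective)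
    {Θ : Module.End ℂ (ℂ ⊗[ℚ] V)} (hΘ : ∀ p, ∀ x ∈ H.piece p (n - p), Θ x = ((2 * p - n : ℤ) : ℂ) • x)
    {B₀ C₀ : Module.End ℂ (ℂ ⊗[ℚ] V)} (hB₀ : B₀ ∈ H.hodgeLieC) (hB₀0 : B₀ ≠ 0)
    (hB₀P : ∀ p ∈ H.piece 1 0, B₀ p = 0) (hB₀im : ∀ v, B₀ v ∈ H.piece 1 0)
    (hC₀ : ∀ v, C₀ v = conj (B₀ (conj v))) {μ₀ : ℂ} (hμ₀ : μ₀ ≠ 0)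
    (hBC : ∀ p ∈ H.piece 1 0, B₀ (C₀ p) = μ₀ • p) (hCB : ∀ q ∈ H.piece 0 1, C₀ (B₀ q) = μ₀ • q)
    (hline : ∀ B ∈ H.hodgeLieC, (∀ p ∈ H.piece 1 0, B p = 0) → (∀ v, B v ∈ H.piece 1 0) → ∃ c : ℂ, B = c • B₀)
    (hline' : ∀ C ∈ H.hodgeLieC, (∀ q ∈ H.piece 0 1, C q = 0) → (∀ v, C v ∈ H.piece 0 1) → ∃ c : ℂ, C = c • C₀)
    {Y : Module.End ℂ (ℂ ⊗[ℚ] V)} (hY : Y ∈ H.hodgeLieC) :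
    ∃ a b c : ℂ, ∃ Y' ∈ H.hodgeLieC, Y = a • B₀ + b • C₀ + c • Θ + Y' ∧
      Y' * Θ = Θ * Y' ∧ Y' * B₀ = B₀ * Y' ∧ Y' * C₀ = C₀ * Y' := by
  classical
  obtain ⟨hC₀Q, hC₀im, hcomm, hΘB, hΘC, hext⟩ := PlusPairTwin.facts H hn heff hΘ hB₀P hB₀im hC₀ hBC hCB
  obtain ⟨hΘΘ1, -⟩ := MumfordNF.sTriple H hn heff hΘ hB₀P hB₀im hC₀ hBC hCB
  subst hn
  obtain ⟨hPmem, hQmem, hΘ10, hΘ01, hΘΘ⟩ := UnitaryTheta.theta_facts H rfl heff hΘ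
  have hΘM : Θ ∈ H.hodgeLieC := H.mem_hodgeLieC_of_forall_piece hΘ
  have hC₀M : C₀ ∈ H.hodgeLieC := conjOp_mem_spanC hB₀ hC₀
  have hbrM : ∀ Y ∈ H.hodgeLieC, ∀ Z ∈ H.hodgeLieC, Y * Z - Z * Y ∈ H.hodgeLieC := fun Y hY Z hZ =>
    H.commutator_mem_hodgeLieC hY hZ
  obtain ⟨Ym, hYm, Y0, hY0, Yp, hYp, hYdec, hYpP, hYpim, hYmQ, hYmim, -, -, hY0P, hY0Q⟩ :=
    SymplecticTheta.exists_decomp H.hodgeLieC hbrM hΘM hΘΘ hΘ10 hΘ01 hPmem hQmem hY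
  obtain ⟨a, hYpeq⟩ := hline Yp hYp hYpP hYpim
  obtain ⟨b, hYmeq⟩ := hline' Ym hYm hYmQ hYmim
  -- `[Y₀, B₀] = λ B₀`
  obtain ⟨lam, hlam⟩ := hline (Y0 * B₀ - B₀ * Y0) (hbrM _ hY0 _ hB₀)
    (fun p hp => by
      rw [LinearMap.sub_apply, Module.End.mul_apply, Module.End.mul_apply, hB₀P p hp, map_zero, hB₀P _ (hY0P p hp),
        sub_zero])
    (fun v => by
      rw [LinearMap.sub_apply, Module.End.mul_apply, Module.End.mul_apply]
      exact sub_mem (hY0P _ (hB₀im v)) (hB₀im _))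
  -- `Y' = Y₀ − (λ/2) Θ`
  set Y' := Y0 - (lam / 2) • Θ with hY'def
  have hY'M : Y' ∈ H.hodgeLieC := sub_mem hY0 (Submodule.smul_mem _ _ hΘM)
  have hY0Θ : Y0 * Θ = Θ * Y0 :=
    hext _ _ (fun p hp => by rw [Module.End.mul_apply, Module.End.mul_apply, hΘ10 p hp, hΘ10 _ (hY0P p hp)])
      (fun q hq => by rw [Module.End.mul_apply, Module.End.mul_apply, hΘ01 q hq, map_neg, hΘ01 _ (hY0Q q hq)])
  have hY'Θ : Y' * Θ = Θ * Y' := by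
    rw [hY'def, sub_mul, mul_sub, hY0Θ, smul_mul_assoc, mul_smul_comm]
  have hY'B : Y' * B₀ = B₀ * Y' := by
    have h1 : Y' * B₀ - B₀ * Y' = (Y0 * B₀ - B₀ * Y0) - (lam / 2) • (Θ * B₀ - B₀ * Θ) := by
      rw [hY'def, sub_mul, mul_sub, smul_mul_assoc, mul_smul_comm, smul_sub]; abel
    rw [← sub_eq_zero, h1, hlam, hΘB, smul_smul, show lam / 2 * 2 = lam by ring, sub_self]
  have hY'P : ∀ p ∈ H.piece 1 0, Y' p ∈ H.piece 1 0 := fun p hp => by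
    rw [hY'def, LinearMap.sub_apply, LinearMap.smul_apply]
    exact sub_mem (hY0P p hp) (Submodule.smul_mem _ _ (by rw [hΘ10 p hp]; exact hp))
  have hY'Q : ∀ q ∈ H.piece 0 1, Y' q ∈ H.piece 0 1 := fun q hq => by
    rw [hY'def, LinearMap.sub_apply, LinearMap.smul_apply]
    exact sub_mem (hY0Q q hq) (Submodule.smul_mem _ _ (by rw [hΘ01 q hq]; exact neg_mem hq))
  -- `[Y', C₀] = λ' C₀`, and `λ' = 0` by Jacobi
  obtain ⟨lam', hlam'⟩ := hline' (Y' * C₀ - C₀ * Y') (hbrM _ hY'M _ hC₀M)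
    (fun q hq => by
      rw [LinearMap.sub_apply, Module.End.mul_apply, Module.End.mul_apply, hC₀Q q hq, map_zero, hC₀Q _ (hY'Q q hq),
        sub_zero])
    (fun v => by
      rw [LinearMap.sub_apply, Module.End.mul_apply, Module.End.mul_apply]
      exact sub_mem (hY'Q _ (hC₀im v)) (hC₀im _))
  have hL : Y' * (B₀ * C₀ - C₀ * B₀) - (B₀ * C₀ - C₀ * B₀) * Y' = 0 := by
    rw [hcomm, mul_smul_comm, smul_mul_assoc, hY'Θ, sub_self]
  have hR : B₀ * (Y' * C₀ - C₀ * Y') - (Y' * C₀ - C₀ * Y') * B₀ = (lam' * μ₀) • Θ := by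
    rw [hlam', mul_smul_comm, smul_mul_assoc, ← smul_smul, ← hcomm, smul_sub]
  have hjac : Y' * (B₀ * C₀ - C₀ * B₀) - (B₀ * C₀ - C₀ * B₀) * Y' =
      B₀ * (Y' * C₀ - C₀ * Y') - (Y' * C₀ - C₀ * Y') * B₀ +
        ((Y' * B₀ - B₀ * Y') * C₀ - C₀ * (Y' * B₀ - B₀ * Y')) := by
    simp only [mul_sub, sub_mul, mul_assoc]; abel
  rw [hL, hR, hY'B, sub_self, zero_mul, mul_zero, sub_zero, add_zero] at hjac
  -- `hjac : 0 = (lam' * μ₀) • Θ`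
  have hlam'0 : lam' = 0 := by
    by_contra hne
    have hΘ0 : Θ = 0 := by
      have h := hjac.symm
      rw [smul_eq_zero] at h
      exact h.resolve_left (mul_ne_zero hne hμ₀)
    have h1 : (1 : Module.End ℂ (ℂ ⊗[ℚ] V)) = 0 := by rw [← hΘΘ1, hΘ0, mul_zero]
    apply hB₀0
    rw [← one_mul B₀, h1, zero_mul]
  have hY'C : Y' * C₀ = C₀ * Y' := by
    rw [← sub_eq_zero, hlam', hlam'0, zero_smul]
  refine ⟨a, b, lam / 2, Y', hY'M, ?_, hY'Θ, hY'B, hY'C⟩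
  rw [hYdec, hYpeq, hYmeq, hY'def]
  abel

set_option maxHeartbeats 1600000 in
/-- **THE THIRD IDEAL (rank eight).**  In the Mumford position (`dim_ℚ V = 8`, `End_Hdg = ℚ`, `𝔥_ℂ = W ⊕ C` with a
three-dimensional ideal `W` commuting with `C` and with `𝔰 = ⟨B₀, C₀, Θ⟩`) there are an `𝔰𝔩₂`-triple `(h', e', f')` spanning `W`
and an `𝔰𝔩₂`-triple `(h'', e'', f'')` in `C` commuting with `𝔰` (and with `W`), BOTH in standard form on `V_ℂ`, such that
`𝔥_ℂ = ⟨Θ, B₀, C₀, h', e', f', h'', e'', f''⟩_ℂ` — «`Hg(X)` is a `ℚ`-form of an almost direct product of three copies of `SL₂`».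
PROOF.  `W = ⟨h', e', f'⟩` by `exists_sl2Triple_of_twin`, standard by `standardForm_of_twin`.  Let `W' = C ∩ Z(𝔰)` (operators of
`C` commuting with `Θ, B₀, C₀`): an `ad 𝔥_ℂ`-stable subspace (`𝔰` is an ideal) commuting with `𝔰 ⊔ W`, and `𝔥_ℂ = W' + (𝔰 + W)`
(`exists_decomp`).  `dim W' ≤ 3`: `W' ⊕ ℂ·1` lies in the joint commutant of the standard triples `(½(1+Θ), B₀, C₀; μ₀)` and
`(½(1+h'), e', f'; 1)`, of dimension `(rk P′P)² = (d/4)² = 4` (`finrank_pairCommutant_eq_sq`, `four_mul_finrank_range_eq`).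
`dim W' ≥ 3`: `W' ≠ 0` (otherwise `𝔥_ℂ = 𝔰 + W` and that commutant would be `End_Hdg ⊗ ℂ = ℂ`, not of dimension `4`), so the
ideal `W'` of the semisimple `𝔥_ℂ` (`isKilling_of_plusLine`) contains an atom, of dimension `≥ 3` (`three_le_finrank_of_isAtom`).
Hence `exists_sl2Triple_of_twin` and `standardForm_of_twin` apply to `W'` with complement `𝔰 + W`.
[cite: MoonenZarhin1999LowDim, Thm. (0.1)(3) and §2 (2.5)(1)] [cite: MoonenZarhin1995Duke, §2 (type I(1))]
[cite: Mumford1969NoteShimura, §4] [cite: Jacobson1962LieAlgebras, Ch. X §1] [cite: FultonHarris1991, Lecture 11 (§11.1)] -/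
theorem MumfordNF.exists_triples (H : HodgeStructure V n) (ψ : H.Polarization) (hn : n = 1)
    (heff : H.IsEffective) (hV : Module.finrank ℚ V = 8) {Θ : Module.End ℂ (ℂ ⊗[ℚ] V)}
    (hΘ : ∀ p, ∀ x ∈ H.piece p (n - p), Θ x = ((2 * p - n : ℤ) : ℂ) • x)
    {B₀ C₀ : Module.End ℂ (ℂ ⊗[ℚ] V)} (hB₀ : B₀ ∈ H.hodgeLieC) (hB₀0 : B₀ ≠ 0)
    (hB₀P : ∀ p ∈ H.piece 1 0, B₀ p = 0) (hB₀im : ∀ v, B₀ v ∈ H.piece 1 0)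
    (hC₀ : ∀ v, C₀ v = conj (B₀ (conj v))) {μ₀ : ℂ} (hμ₀ : μ₀ ≠ 0)
    (hBC : ∀ p ∈ H.piece 1 0, B₀ (C₀ p) = μ₀ • p) (hCB : ∀ q ∈ H.piece 0 1, C₀ (B₀ q) = μ₀ • q)
    (hline : ∀ B ∈ H.hodgeLieC, (∀ p ∈ H.piece 1 0, B p = 0) → (∀ v, B v ∈ H.piece 1 0) → ∃ c : ℂ, B = c • B₀)
    (hline' : ∀ C ∈ H.hodgeLieC, (∀ q ∈ H.piece 0 1, C q = 0) → (∀ v, C v ∈ H.piece 0 1) → ∃ c : ℂ, C = c • C₀)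
    (hE : ∀ a ∈ H.endAlg, ∃ x : ℚ, a = x • (1 : Module.End ℚ V))
    {W C : Submodule ℂ (Module.End ℂ (ℂ ⊗[ℚ] V))} (hWle : W ≤ H.hodgeLieC) (hCle : C ≤ H.hodgeLieC)
    (hWC : W ⊔ C = H.hodgeLieC) (hW3 : Module.finrank ℂ W = 3)
    (hWst : ∀ Y ∈ H.hodgeLieC, ∀ w ∈ W, Y * w - w * Y ∈ W) (hCst : ∀ Y ∈ H.hodgeLieC, ∀ c ∈ C, Y * c - c * Y ∈ C)
    (hcommWC : ∀ w ∈ W, ∀ c ∈ C, w * c = c * w)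
    (hW𝔰 : ∀ w ∈ W, ∀ s ∈ Submodule.span ℂ (Set.range ![B₀, C₀, Θ]), w * s = s * w) :
    ∃ h' e' f' h'' e'' f'' : Module.End ℂ (ℂ ⊗[ℚ] V),
      (h' ∈ W ∧ e' ∈ W ∧ f' ∈ W) ∧ (h'' ∈ C ∧ e'' ∈ C ∧ f'' ∈ C) ∧
      (h' * h' = 1 ∧ e' * e' = 0 ∧ f' * f' = 0 ∧ e' * f' = (2 : ℂ)⁻¹ • (1 + h') ∧ f' * e' = (2 : ℂ)⁻¹ • (1 - h') ∧
        h' * e' = e' ∧ e' * h' = -e' ∧ h' * f' = -f' ∧ f' * h' = f') ∧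
      (h'' * h'' = 1 ∧ e'' * e'' = 0 ∧ f'' * f'' = 0 ∧ e'' * f'' = (2 : ℂ)⁻¹ • (1 + h'') ∧
        f'' * e'' = (2 : ℂ)⁻¹ • (1 - h'') ∧ h'' * e'' = e'' ∧ e'' * h'' = -e'' ∧ h'' * f'' = -f'' ∧ f'' * h'' = f'') ∧
      (∀ x ∈ ({h'', e'', f''} : Set (Module.End ℂ (ℂ ⊗[ℚ] V))), x * Θ = Θ * x ∧ x * B₀ = B₀ * x ∧ x * C₀ = C₀ * x) ∧
      H.hodgeLieC = Submodule.span ℂ (Set.range ![Θ, B₀, C₀, h', e', f', h'', e'', f'']) := by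
  classical
  letI iC : LieRing (Module.End ℂ (ℂ ⊗[ℚ] V)) := LieRing.ofAssociativeRing
  obtain ⟨hC₀Q, hC₀im, hcomm, hΘB, hΘC, hext⟩ := PlusPairTwin.facts H hn heff hΘ hB₀P hB₀im hC₀ hBC hCB
  obtain ⟨hΘΘ1, -, -, hPP, hPB, hBP, hPC, hCP, hBCP, hCBP, -, -, -, -, hΘP, -⟩ :=
    MumfordNF.sTriple H hn heff hΘ hB₀P hB₀im hC₀ hBC hCB
  have hz := hodgeLie_inf_endAlg_eq_bot_of_forall_endAlg_eq_smul H ψ hE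
  have hΘM : Θ ∈ H.hodgeLieC := H.mem_hodgeLieC_of_forall_piece hΘ
  have hC₀M : C₀ ∈ H.hodgeLieC := conjOp_mem_spanC hB₀ hC₀
  set 𝔰 := Submodule.span ℂ (Set.range ![B₀, C₀, Θ]) with h𝔰def
  have hideal : ∀ Y ∈ H.hodgeLieC, ∀ s ∈ 𝔰, Y * s - s * Y ∈ 𝔰 :=
    PlusPairTwin.lie_mem_span H hn heff hΘ hB₀ hB₀P hB₀im hC₀ hBC hCB hline hline'
  have hB₀𝔰 : B₀ ∈ 𝔰 := Submodule.subset_span ⟨0, rfl⟩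
  have hC₀𝔰 : C₀ ∈ 𝔰 := Submodule.subset_span ⟨1, rfl⟩
  have hΘ𝔰 : Θ ∈ 𝔰 := Submodule.subset_span ⟨2, rfl⟩
  have h𝔰le : 𝔰 ≤ H.hodgeLieC := by
    rw [h𝔰def, Submodule.span_le]
    rintro _ ⟨i, rfl⟩
    fin_cases i
    · exact hB₀
    · exact hC₀M
    · exact hΘM
  -- `V_ℂ ≠ 0`, so `1 ≠ 0` and `ψ_ℂ ≠ 0`
  haveI hVnt : Nontrivial (ℂ ⊗[ℚ] V) := by
    by_contra hnt
    rw [not_nontrivial_iff_subsingleton] at hnt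
    exact hB₀0 (Subsingleton.elim _ _)
  have h1ne : (1 : Module.End ℂ (ℂ ⊗[ℚ] V)) ≠ 0 := one_ne_zero
  have h1notin : (1 : Module.End ℂ (ℂ ⊗[ℚ] V)) ∉ H.hodgeLieC := by
    intro h1
    obtain ⟨x, hx⟩ := exists_ne (0 : ℂ ⊗[ℚ] V)
    obtain ⟨y, hy⟩ : ∃ y, ψ.form.baseChange ℂ x y ≠ 0 := by
      by_contra hno
      push Not at hno
      exact hx (ψ.nondegenerate_baseChange.1 x hno)
    have h := formBaseChange_skew_of_mem_hodgeLieC ψ h1 x y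
    rw [Module.End.one_apply, Module.End.one_apply] at h
    exact hy (CharZero.eq_neg_self_iff.1 h)
  -- two small commutation helpers: with `P = ½(1 + Θ)` and back
  set P := (2 : ℂ)⁻¹ • (1 + Θ) with hPdef
  have commP : ∀ {T : Module.End ℂ (ℂ ⊗[ℚ] V)}, T * Θ = Θ * T → T * P = P * T := fun {T} hT => by
    rw [hPdef, mul_smul_comm, smul_mul_assoc, mul_add, add_mul, mul_one, one_mul, hT]
  have hΘofP : Θ = (2 : ℂ) • P - 1 := by rw [hPdef, smul_smul, mul_inv_cancel₀ (two_ne_zero' ℂ), one_smul]; abel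
  have commΘ : ∀ {T : Module.End ℂ (ℂ ⊗[ℚ] V)}, T * P = P * T → T * Θ = Θ * T := fun {T} hT => by
    rw [hΘofP, mul_sub, sub_mul, mul_smul_comm, smul_mul_assoc, hT, mul_one, one_mul]
  -- (B) the triple of `W`, in standard form
  obtain ⟨h', e', f', hh', he', hf', hHE, hHF, hEF, hspanW⟩ := exists_sl2Triple_of_twin H ψ hn heff hΘ hB₀ hB₀0 hB₀P hB₀im
    hC₀ hμ₀ hBC hCB hline hline' hz hWle hCle hWC hW3 hWst hcommWC
  obtain ⟨hhh, hee, hff, hef, hfe, hhe, heh, hhf, hfh⟩ := MumfordNF.standardForm_of_twin H ψ hn heff hΘ hB₀ hB₀0 hB₀P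
    hB₀im hC₀ hμ₀ hBC hCB hline hline' hE hWle hWC hW3 hcommWC hh' he' hf' hHE hHF hEF hspanW
  -- (C) the third ideal `W' = C ∩ Z(𝔰)`
  obtain ⟨Z, hZ⟩ := SL2Triple.exists_submodule_commutant₃ (K := ℂ) Θ B₀ C₀
  set W' : Submodule ℂ (Module.End ℂ (ℂ ⊗[ℚ] V)) := C ⊓ Z with hW'def
  have hW'le : W' ≤ H.hodgeLieC := inf_le_left.trans hCle
  have hW'Z : ∀ w ∈ W', w * Θ = Θ * w ∧ w * B₀ = B₀ * w ∧ w * C₀ = C₀ * w := fun w hw => (hZ w).1 hw.2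
  have hW'st : ∀ Y ∈ H.hodgeLieC, ∀ w ∈ W', Y * w - w * Y ∈ W' := by
    intro Y hY w hw
    refine ⟨hCst Y hY w hw.1, (hZ _).2 ?_⟩
    obtain ⟨hwΘ, hwB, hwC⟩ := hW'Z w hw
    have hw𝔰 := MumfordNF.commute_span_of_commute hwΘ hwB hwC
    have key : ∀ s ∈ 𝔰, (Y * w - w * Y) * s = s * (Y * w - w * Y) := fun s hs => by
      have h1 : (Y * w - w * Y) * s - s * (Y * w - w * Y) =
          ((Y * s - s * Y) * w - w * (Y * s - s * Y)) + (Y * (w * s - s * w) + (s * w - w * s) * Y) := by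
        simp only [mul_sub, sub_mul, mul_assoc]; abel
      rw [← sub_eq_zero, h1, hw𝔰 s hs, sub_self, mul_zero, zero_mul, add_zero, add_zero, hw𝔰 _ (hideal Y hY s hs),
        sub_self]
    exact ⟨key Θ hΘ𝔰, key B₀ hB₀𝔰, key C₀ hC₀𝔰⟩
  -- (D) `𝔥_ℂ = W' + (𝔰 + W)`
  have hsum : W' ⊔ (𝔰 ⊔ W) = H.hodgeLieC := by
    refine le_antisymm (sup_le hW'le (sup_le h𝔰le hWle)) fun Y hY => ?_
    obtain ⟨a, b, c, Y', hY'M, hYeq, hY'Θ, hY'B, hY'C⟩ :=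
      MumfordNF.exists_decomp H hn heff hΘ hB₀ hB₀0 hB₀P hB₀im hC₀ hμ₀ hBC hCB hline hline' hY
    have hY'WC : Y' ∈ W ⊔ C := by rw [hWC]; exact hY'M
    obtain ⟨w, hw, cc, hcc, hwcc⟩ := Submodule.mem_sup.1 hY'WC
    have hcc' : cc = Y' - w := by rw [← hwcc]; abel
    have hccZ : cc ∈ Z := by
      rw [hZ, hcc']
      exact ⟨by rw [sub_mul, mul_sub, hY'Θ, hW𝔰 w hw Θ hΘ𝔰], by rw [sub_mul, mul_sub, hY'B, hW𝔰 w hw B₀ hB₀𝔰],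
        by rw [sub_mul, mul_sub, hY'C, hW𝔰 w hw C₀ hC₀𝔰]⟩
    have hs𝔰 : a • B₀ + b • C₀ + c • Θ ∈ 𝔰 :=
      add_mem (add_mem (Submodule.smul_mem _ _ hB₀𝔰) (Submodule.smul_mem _ _ hC₀𝔰)) (Submodule.smul_mem _ _ hΘ𝔰)
    rw [hYeq, ← hwcc, ← add_assoc]
    exact add_mem (add_mem (Submodule.mem_sup_right (Submodule.mem_sup_left hs𝔰))
      (Submodule.mem_sup_right (Submodule.mem_sup_right hw))) (Submodule.mem_sup_left ⟨hcc, hccZ⟩)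
  have hcommW' : ∀ w' ∈ W', ∀ c ∈ 𝔰 ⊔ W, w' * c = c * w' := by
    intro w' hw' c hc
    obtain ⟨s, hs, w, hw, rfl⟩ := Submodule.mem_sup.1 hc
    obtain ⟨hΘ', hB', hC'⟩ := hW'Z w' hw'
    rw [mul_add, add_mul, MumfordNF.commute_span_of_commute hΘ' hB' hC' s hs, hcommWC w hw w' hw'.1]
  -- (F2) `dim W' ≤ 3`: the joint commutant of the two standard triples
  set P' := (2 : ℂ)⁻¹ • (1 + h') with hP'def
  have commP' : ∀ {T : Module.End ℂ (ℂ ⊗[ℚ] V)}, T * h' = h' * T → T * P' = P' * T := fun {T} hT => by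
    rw [hP'def, mul_smul_comm, smul_mul_assoc, mul_add, add_mul, mul_one, one_mul, hT]
  have hh'ofP' : h' = (2 : ℂ) • P' - 1 := by
    rw [hP'def, smul_smul, mul_inv_cancel₀ (two_ne_zero' ℂ), one_smul]; abel
  have commh' : ∀ {T : Module.End ℂ (ℂ ⊗[ℚ] V)}, T * P' = P' * T → T * h' = h' * T := fun {T} hT => by
    rw [hh'ofP', mul_sub, sub_mul, mul_smul_comm, smul_mul_assoc, hT, mul_one, one_mul]
  obtain ⟨D1, hD1⟩ := SL2Triple.exists_submodule_commutant₃ (K := ℂ) P B₀ C₀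
  obtain ⟨D2, hD2⟩ := SL2Triple.exists_submodule_commutant₃ (K := ℂ) P' e' f'
  have h𝒟 : ∀ T, T ∈ D1 ⊓ D2 ↔ (T * P = P * T ∧ T * B₀ = B₀ * T ∧ T * C₀ = C₀ * T) ∧
      (T * P' = P' * T ∧ T * e' = e' * T ∧ T * f' = f' * T) := fun T => by
    rw [Submodule.mem_inf, hD1, hD2]
  have hP'P' : P' * P' = P' := by
    have h2 : (1 + h') * (1 + h') = (2 : ℂ) • (1 + h') := by
      rw [add_mul, one_mul, mul_add, mul_one, hhh, two_smul]; abel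
    rw [hP'def, smul_mul_assoc, mul_smul_comm, smul_smul, h2, smul_smul]; norm_num
  have hP'e : P' * e' = e' := by rw [hP'def, smul_mul_assoc, add_mul, one_mul, hhe]; module
  have he'P' : e' * P' = 0 := by rw [hP'def, mul_smul_comm, mul_add, mul_one, heh]; module
  have hP'f : P' * f' = 0 := by rw [hP'def, smul_mul_assoc, add_mul, one_mul, hhf]; module
  have hf'P' : f' * P' = f' := by rw [hP'def, mul_smul_comm, mul_add, mul_one, hfh]; module
  have he'f' : e' * f' = (1 : ℂ) • P' := by rw [one_smul, hef]
  have hf'e' : f' * e' = (1 : ℂ) • (1 - P') := by rw [one_smul, hfe, hP'def]; module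
  -- commutations of `W ∋ h', e', f'` with `𝔰 ∋ Θ, B₀, C₀`
  have hh'Θ : h' * Θ = Θ * h' := hW𝔰 h' hh' Θ hΘ𝔰
  have hh'P : h' * P = P * h' := commP hh'Θ
  have he'P : e' * P = P * e' := commP (hW𝔰 e' he' Θ hΘ𝔰)
  have hf'P : f' * P = P * f' := commP (hW𝔰 f' hf' Θ hΘ𝔰)
  have hP'P : P' * P = P * P' := (commP' hh'P.symm).symm
  have hP'B : P' * B₀ = B₀ * P' := (commP' (hW𝔰 h' hh' B₀ hB₀𝔰).symm).symm
  have hP'C : P' * C₀ = C₀ * P' := (commP' (hW𝔰 h' hh' C₀ hC₀𝔰).symm).symm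
  have hdimD : Module.finrank ℂ ↥(D1 ⊓ D2) = Module.finrank ℂ (LinearMap.range (P' * P)) ^ 2 :=
    SL2Triple.finrank_pairCommutant_eq_sq hμ₀ hPP hPB hBP hPC hCP hBCP hCBP one_ne_zero hP'P' hP'e he'P' hP'f hf'P' he'f' hf'e'
      hP'P hP'B hP'C he'P (hW𝔰 e' he' B₀ hB₀𝔰) (hW𝔰 e' he' C₀ hC₀𝔰) hf'P (hW𝔰 f' hf' B₀ hB₀𝔰) (hW𝔰 f' hf' C₀ hC₀𝔰) h𝒟
  have hrk : Module.finrank ℂ (LinearMap.range (P' * P)) = 2 := by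
    have h4 := four_mul_finrank_range_eq (V := V) hμ₀ hPP hBCP hCBP hh'P he'P hEF hhh
    rw [hV, ← hP'def] at h4
    omega
  rw [hrk] at hdimD
  norm_num at hdimD
  -- `W' ≤ 𝒟`, `1 ∈ 𝒟`, `1 ∉ W'`
  have hW'D : W' ≤ D1 ⊓ D2 := fun w hw => by
    obtain ⟨hΘ', hB', hC'⟩ := hW'Z w hw
    exact (h𝒟 w).2 ⟨⟨commP hΘ', hB', hC'⟩,
      ⟨commP' (hcommWC h' hh' w hw.1).symm, (hcommWC e' he' w hw.1).symm, (hcommWC f' hf' w hw.1).symm⟩⟩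
  have h1D : (1 : Module.End ℂ (ℂ ⊗[ℚ] V)) ∈ D1 ⊓ D2 :=
    (h𝒟 1).2 ⟨⟨by rw [one_mul, mul_one], by rw [one_mul, mul_one], by rw [one_mul, mul_one]⟩,
      ⟨by rw [one_mul, mul_one], by rw [one_mul, mul_one], by rw [one_mul, mul_one]⟩⟩
  have hW'1 : W' ⊓ Submodule.span ℂ {(1 : Module.End ℂ (ℂ ⊗[ℚ] V))} = ⊥ := by
    rw [eq_bot_iff]
    intro x hx
    obtain ⟨hxW, hx1⟩ := Submodule.mem_inf.1 hx
    obtain ⟨c, rfl⟩ := Submodule.mem_span_singleton.1 hx1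
    rw [Submodule.mem_bot]
    by_cases hc : c = 0
    · rw [hc, zero_smul]
    · exfalso
      apply h1notin
      have h := Submodule.smul_mem _ c⁻¹ (hW'le hxW)
      rwa [smul_smul, inv_mul_cancel₀ hc, one_smul] at h
  have hle3 : Module.finrank ℂ W' ≤ 3 := by
    have hsup : Module.finrank ℂ ↥(W' ⊔ Submodule.span ℂ {(1 : Module.End ℂ (ℂ ⊗[ℚ] V))}) ≤ 4 := by
      rw [← hdimD]
      exact Submodule.finrank_mono (sup_le hW'D ((Submodule.span_singleton_le_iff_mem _ _).2 h1D))
    have hadd := Submodule.finrank_sup_add_finrank_inf_eq W' (Submodule.span ℂ {(1 : Module.End ℂ (ℂ ⊗[ℚ] V))})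
    rw [hW'1, finrank_bot, add_zero, finrank_span_singleton h1ne] at hadd
    omega
  -- (F3) `W' ≠ 0`
  have hW'ne : W' ≠ ⊥ := by
    intro hbot
    -- every `T ∈ 𝒟` commutes with `𝔥_ℂ = 𝔰 + W`, hence is a scalar
    have hDle : D1 ⊓ D2 ≤ Submodule.span ℂ {(1 : Module.End ℂ (ℂ ⊗[ℚ] V))} := by
      intro T hT
      obtain ⟨⟨hTP, hTB, hTC⟩, ⟨hTP', hTe, hTf⟩⟩ := (h𝒟 T).1 hT
      have hT𝔰 := MumfordNF.commute_span_of_commute (commΘ hTP) hTB hTC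
      have hTh : T * h' = h' * T := commh' hTP'
      have hTW : ∀ w ∈ W, T * w = w * T := fun w hw => by
        obtain ⟨a, b, c, rfl⟩ := hspanW w hw
        rw [mul_add, mul_add, add_mul, add_mul, mul_smul_comm, mul_smul_comm, mul_smul_comm, smul_mul_assoc,
          smul_mul_assoc, smul_mul_assoc, hTh, hTe, hTf]
      have hTcomm : ∀ X ∈ H.hodgeLie, T * X.baseChange ℂ = X.baseChange ℂ * T := fun X hX => by
        have hXm : X.baseChange ℂ ∈ W' ⊔ (𝔰 ⊔ W) := by rw [hsum]; exact H.baseChange_mem_hodgeLieC hX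
        rw [hbot, bot_sup_eq] at hXm
        obtain ⟨s, hs, w, hw, hsw⟩ := Submodule.mem_sup.1 hXm
        rw [← hsw, mul_add, add_mul, hT𝔰 s hs, hTW w hw]
      have hTspan := mem_span_endAlg_of_forall_commute H hTcomm
      refine (Submodule.span_le.2 ?_) hTspan
      rintro _ ⟨a, ha, rfl⟩
      obtain ⟨x, rfl⟩ := hE a ha
      change (x • (1 : Module.End ℚ V)).baseChange ℂ ∈ Submodule.span ℂ {(1 : Module.End ℂ (ℂ ⊗[ℚ] V))}
      rw [LinearMap.baseChange_smul, LinearMap.baseChange_one]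
      exact Submodule.smul_of_tower_mem _ x (Submodule.subset_span rfl)
    have h := Submodule.finrank_mono hDle
    rw [hdimD, finrank_span_singleton h1ne] at h
    omega
  -- … and a non-zero ideal of the semisimple `𝔥_ℂ` has dimension `≥ 3`
  obtain ⟨𝔏', h𝔏'⟩ := exists_lieSubalgebra_eq_hodgeLieC H
  have hmem𝔏' : ∀ {x}, x ∈ 𝔏' ↔ x ∈ H.hodgeLieC := fun {x} => by rw [← LieSubalgebra.mem_toSubmodule, h𝔏']
  haveI : Module.Finite ℂ 𝔏' := Module.Finite.of_injective 𝔏'.toSubmodule.subtype Subtype.val_injective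
  haveI hK : LieAlgebra.IsKilling ℂ 𝔏' :=
    isKilling_of_plusLine H ψ hn heff hΘ hB₀ hB₀0 hB₀P hB₀im hC₀ hμ₀ hBC hCB hline hz 𝔏' h𝔏'
  let W'𝔩 : LieIdeal ℂ 𝔏' :=
    { (W'.comap 𝔏'.toSubmodule.subtype) with
      lie_mem := fun {x m} hm => by
        change ((⁅x, m⁆ : 𝔏') : Module.End ℂ (ℂ ⊗[ℚ] V)) ∈ W'
        rw [LieSubalgebra.coe_bracket, LieRing.of_associative_ring_bracket]
        exact hW'st _ (hmem𝔏'.1 x.2) _ hm }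
  have hmemW'𝔩 : ∀ x : 𝔏', x ∈ W'𝔩 ↔ (x : Module.End ℂ (ℂ ⊗[ℚ] V)) ∈ W' := fun x => Iff.rfl
  have hW'𝔩fin : Module.finrank ℂ W'𝔩 = Module.finrank ℂ W' := by
    have hle' : W' ≤ 𝔏'.toSubmodule := by rw [h𝔏']; exact hW'le
    exact (Submodule.comapSubtypeEquivOfLe hle').finrank_eq
  have hW'𝔩ne : W'𝔩 ≠ ⊥ := by
    obtain ⟨w, hw, hw0⟩ := (Submodule.ne_bot_iff W').1 hW'ne
    intro hbot
    have hmem : (⟨w, hmem𝔏'.2 (hW'le hw)⟩ : 𝔏') ∈ W'𝔩 := (hmemW'𝔩 _).2 hw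
    rw [hbot, LieSubmodule.mem_bot] at hmem
    exact hw0 (congrArg Subtype.val hmem)
  obtain ⟨A, hA, hAle⟩ := (eq_bot_or_exists_atom_le W'𝔩).resolve_left hW'𝔩ne
  have h3A := SemisimpleSmallDimension.three_le_finrank_of_isAtom (K := ℂ) hA
  have hAle' : Module.finrank ℂ A ≤ Module.finrank ℂ W'𝔩 :=
    Submodule.finrank_mono (show A.toSubmodule ≤ W'𝔩.toSubmodule from hAle)
  have hW'3 : Module.finrank ℂ W' = 3 := by
    have e1 : Module.finrank ℂ A.toSubmodule = Module.finrank ℂ A := rfl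
    have e2 : Module.finrank ℂ W'𝔩.toSubmodule = Module.finrank ℂ W'𝔩 := rfl
    omega
  -- (G) the triple of `W'`, in standard form
  obtain ⟨h'', e'', f'', hh'', he'', hf'', hHE', hHF', hEF', hspanW'⟩ := exists_sl2Triple_of_twin H ψ hn heff hΘ hB₀ hB₀0
    hB₀P hB₀im hC₀ hμ₀ hBC hCB hline hline' hz hW'le (sup_le h𝔰le hWle) hsum hW'3 hW'st hcommW'
  have hstd'' := MumfordNF.standardForm_of_twin H ψ hn heff hΘ hB₀ hB₀0 hB₀P hB₀im hC₀ hμ₀ hBC hCB hline hline' hE hW'le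
    hsum hW'3 hcommW' hh'' he'' hf'' hHE' hHF' hEF' hspanW'
  -- (H) assemble
  refine ⟨h', e', f', h'', e'', f'', ⟨hh', he', hf'⟩, ⟨hh''.1, he''.1, hf''.1⟩,
    ⟨hhh, hee, hff, hef, hfe, hhe, heh, hhf, hfh⟩, hstd'', ?_, ?_⟩
  · intro x hx
    rcases hx with rfl | rfl | rfl
    · exact hW'Z _ hh''
    · exact hW'Z _ he''
    · exact hW'Z _ hf''
  · refine le_antisymm ?_ ?_
    · rw [← hsum]
      refine sup_le ?_ (sup_le ?_ ?_)
      · intro w hw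
        obtain ⟨a, b, c, rfl⟩ := hspanW' w hw
        exact add_mem (add_mem (Submodule.smul_mem _ _ (Submodule.subset_span ⟨6, rfl⟩))
          (Submodule.smul_mem _ _ (Submodule.subset_span ⟨7, rfl⟩))) (Submodule.smul_mem _ _ (Submodule.subset_span ⟨8, rfl⟩))
      · rw [h𝔰def, Submodule.span_le]
        rintro _ ⟨i, rfl⟩
        fin_cases i
        · exact Submodule.subset_span ⟨1, rfl⟩
        · exact Submodule.subset_span ⟨2, rfl⟩
        · exact Submodule.subset_span ⟨0, rfl⟩
      · intro w hw
        obtain ⟨a, b, c, rfl⟩ := hspanW w hw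
        exact add_mem (add_mem (Submodule.smul_mem _ _ (Submodule.subset_span ⟨3, rfl⟩))
          (Submodule.smul_mem _ _ (Submodule.subset_span ⟨4, rfl⟩))) (Submodule.smul_mem _ _ (Submodule.subset_span ⟨5, rfl⟩))
    · rw [Submodule.span_le]
      rintro _ ⟨i, rfl⟩
      fin_cases i
      · exact hΘM
      · exact hB₀
      · exact hC₀M
      · exact hWle hh'
      · exact hWle he'
      · exact hWle hf'
      · exact hW'le hh''
      · exact hW'le he''
      · exact hW'le hf''

/-! ## §4 The normal form: three commuting standard `𝔰𝔩₂`-triples spanning `Lie Hg ⊗ ℂ` -/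

set_option maxHeartbeats 1600000 in
/-- **THE NORMAL FORM OF THE MUMFORD POSITION (rank eight, `End_Hdg = ℚ`).**  Given the Mumford-position data of
`hodgeLieC_rankEight_dichotomy` for a polarized weight-one Hodge structure `H` with `dim_ℚ V = 8` and `End_Hdg(V) = ℚ`, there are
THREE `𝔰𝔩₂`-TRIPLES OF OPERATORS `(H_i, E_i, F_i)`, `i = 0, 1, 2`, in `Lie Hg ⊗ ℂ`, with `(H₀, E₀, F₀) = (Θ, B₀, μ₀⁻¹ C₀)`, each in
STANDARD FORM on `V_ℂ` (`H_i² = 1`, `E_i² = F_i² = 0`, `E_iF_i = ½(1 + H_i)`, `F_iE_i = ½(1 − H_i)`, `H_iE_i = E_i = −E_iH_i`,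
`H_iF_i = −F_i = −F_iH_i`), any two operators from different triples COMMUTING, and `Lie Hg ⊗ ℂ` the span of the nine — the
operator form of «`Hg(X)` is a `ℚ`-form of an almost direct product of three copies of `SL₂`» acting on `V_ℂ = 2 ⊠ 2 ⊠ 2`
(Moonen–Zarhin (2.5)(1), Mumford §4), obtained here WITHOUT the classification of `(Lie Hg ⊗ ℂ, V_ℂ)`
(`MumfordNF.exists_triples`). [cite: MoonenZarhin1999LowDim, Thm. (0.1)(3) and §2 (2.5)(1)]
[cite: MoonenZarhin1995Duke, §2 (type I(1))] [cite: Mumford1969NoteShimura, §4] [cite: FultonHarris1991, Lecture 11 (§11.1)] -/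
theorem exists_mumford_normalForm (H : HodgeStructure V n) (ψ : H.Polarization) (hn : n = 1)
    (heff : H.IsEffective) (hV : Module.finrank ℚ V = 8) {Θ : Module.End ℂ (ℂ ⊗[ℚ] V)}
    (hΘ : ∀ p, ∀ x ∈ H.piece p (n - p), Θ x = ((2 * p - n : ℤ) : ℂ) • x)
    {B₀ C₀ : Module.End ℂ (ℂ ⊗[ℚ] V)} (hB₀ : B₀ ∈ H.hodgeLieC) (hB₀0 : B₀ ≠ 0)
    (hB₀P : ∀ p ∈ H.piece 1 0, B₀ p = 0) (hB₀im : ∀ v, B₀ v ∈ H.piece 1 0)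
    (hC₀ : ∀ v, C₀ v = conj (B₀ (conj v))) {μ₀ : ℂ} (hμ₀ : μ₀ ≠ 0)
    (hBC : ∀ p ∈ H.piece 1 0, B₀ (C₀ p) = μ₀ • p) (hCB : ∀ q ∈ H.piece 0 1, C₀ (B₀ q) = μ₀ • q)
    (hline : ∀ B ∈ H.hodgeLieC, (∀ p ∈ H.piece 1 0, B p = 0) → (∀ v, B v ∈ H.piece 1 0) → ∃ c : ℂ, B = c • B₀)
    (hline' : ∀ C ∈ H.hodgeLieC, (∀ q ∈ H.piece 0 1, C q = 0) → (∀ v, C v ∈ H.piece 0 1) → ∃ c : ℂ, C = c • C₀)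
    (hE : ∀ a ∈ H.endAlg, ∃ x : ℚ, a = x • (1 : Module.End ℚ V))
    {W C : Submodule ℂ (Module.End ℂ (ℂ ⊗[ℚ] V))} (hWle : W ≤ H.hodgeLieC) (hCle : C ≤ H.hodgeLieC)
    (hWC : W ⊔ C = H.hodgeLieC) (hW3 : Module.finrank ℂ W = 3)
    (hWst : ∀ Y ∈ H.hodgeLieC, ∀ w ∈ W, Y * w - w * Y ∈ W) (hCst : ∀ Y ∈ H.hodgeLieC, ∀ c ∈ C, Y * c - c * Y ∈ C)
    (hcommWC : ∀ w ∈ W, ∀ c ∈ C, w * c = c * w)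
    (hW𝔰 : ∀ w ∈ W, ∀ s ∈ Submodule.span ℂ (Set.range ![B₀, C₀, Θ]), w * s = s * w) :
    ∃ Hh Ee Ff : Fin 3 → Module.End ℂ (ℂ ⊗[ℚ] V),
      Hh 0 = Θ ∧ Ee 0 = B₀ ∧ Ff 0 = μ₀⁻¹ • C₀ ∧
      (∀ i, Hh i ∈ H.hodgeLieC ∧ Ee i ∈ H.hodgeLieC ∧ Ff i ∈ H.hodgeLieC) ∧
      (∀ i, Hh i * Hh i = 1 ∧ Ee i * Ee i = 0 ∧ Ff i * Ff i = 0 ∧ Ee i * Ff i = (2 : ℂ)⁻¹ • (1 + Hh i) ∧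
        Ff i * Ee i = (2 : ℂ)⁻¹ • (1 - Hh i) ∧ Hh i * Ee i = Ee i ∧ Ee i * Hh i = -Ee i ∧ Hh i * Ff i = -Ff i ∧
        Ff i * Hh i = Ff i) ∧
      (∀ i j, i ≠ j →
        Hh i * Hh j = Hh j * Hh i ∧ Hh i * Ee j = Ee j * Hh i ∧ Hh i * Ff j = Ff j * Hh i ∧
        Ee i * Hh j = Hh j * Ee i ∧ Ee i * Ee j = Ee j * Ee i ∧ Ee i * Ff j = Ff j * Ee i ∧
        Ff i * Hh j = Hh j * Ff i ∧ Ff i * Ee j = Ee j * Ff i ∧ Ff i * Ff j = Ff j * Ff i) ∧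
      H.hodgeLieC = Submodule.span ℂ (Set.range Hh ∪ Set.range Ee ∪ Set.range Ff) := by
  classical
  obtain ⟨hC₀Q, hC₀im, hcomm, -, -, hext⟩ := PlusPairTwin.facts H hn heff hΘ hB₀P hB₀im hC₀ hBC hCB
  obtain ⟨hΘΘ1, hBB, hCC, -, -, -, -, -, hBCP, hCBP, hΘB1, hBΘ1, hΘC1, hCΘ1, -, -⟩ :=
    MumfordNF.sTriple H hn heff hΘ hB₀P hB₀im hC₀ hBC hCB
  have hΘM : Θ ∈ H.hodgeLieC := H.mem_hodgeLieC_of_forall_piece hΘ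
  have hC₀M : C₀ ∈ H.hodgeLieC := conjOp_mem_spanC hB₀ hC₀
  obtain ⟨h', e', f', h'', e'', f'', ⟨hh', he', hf'⟩, ⟨hh'', he'', hf''⟩, ⟨hhh, hee, hff, hef, hfe, hhe, heh, hhf, hfh⟩,
    ⟨hhh', hee', hff', hef', hfe', hhe', heh', hhf', hfh'⟩, hZ, hspan⟩ :=
    MumfordNF.exists_triples H ψ hn heff hV hΘ hB₀ hB₀0 hB₀P hB₀im hC₀ hμ₀ hBC hCB hline hline' hE hWle hCle hWC hW3 hWst
      hCst hcommWC hW𝔰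
  -- membership of the `𝔰`-generators in `𝔰`
  have hB₀𝔰 : B₀ ∈ Submodule.span ℂ (Set.range ![B₀, C₀, Θ]) := Submodule.subset_span ⟨0, rfl⟩
  have hC₀𝔰 : μ₀⁻¹ • C₀ ∈ Submodule.span ℂ (Set.range ![B₀, C₀, Θ]) :=
    Submodule.smul_mem _ _ (Submodule.subset_span ⟨1, rfl⟩)
  have hΘ𝔰 : Θ ∈ Submodule.span ℂ (Set.range ![B₀, C₀, Θ]) := Submodule.subset_span ⟨2, rfl⟩
  -- the `𝔰`-triple in standard form
  have hs1 : B₀ * (μ₀⁻¹ • C₀) = (2 : ℂ)⁻¹ • (1 + Θ) := by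
    rw [mul_smul_comm, hBCP, smul_smul, inv_mul_cancel₀ hμ₀, one_smul]
  have hs2 : (μ₀⁻¹ • C₀) * B₀ = (2 : ℂ)⁻¹ • (1 - Θ) := by
    rw [smul_mul_assoc, hCBP, smul_smul, inv_mul_cancel₀ hμ₀, one_smul]; module
  have hs3 : (μ₀⁻¹ • C₀) * (μ₀⁻¹ • C₀) = 0 := by rw [smul_mul_assoc, mul_smul_comm, hCC, smul_zero, smul_zero]
  have hs4 : Θ * (μ₀⁻¹ • C₀) = -(μ₀⁻¹ • C₀) := by rw [mul_smul_comm, hΘC1, smul_neg]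
  have hs5 : (μ₀⁻¹ • C₀) * Θ = μ₀⁻¹ • C₀ := by rw [smul_mul_assoc, hCΘ1]
  -- commutation data: `W ∋ h', e', f'` with `𝔰`; `W' ∋ h'', e'', f''` with `𝔰` and with `W`
  have hZ' : ∀ x ∈ ({h'', e'', f''} : Set (Module.End ℂ (ℂ ⊗[ℚ] V))),
      x * Θ = Θ * x ∧ x * B₀ = B₀ * x ∧ x * (μ₀⁻¹ • C₀) = (μ₀⁻¹ • C₀) * x := fun x hx => by
    obtain ⟨h1, h2, h3⟩ := hZ x hx
    exact ⟨h1, h2, by rw [mul_smul_comm, smul_mul_assoc, h3]⟩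
  -- the three triples
  let ops : Fin 3 → Fin 3 → Module.End ℂ (ℂ ⊗[ℚ] V) :=
    ![![Θ, B₀, μ₀⁻¹ • C₀], ![h', e', f'], ![h'', e'', f'']]
  have hops0 : ∀ a, ops 0 a ∈ Submodule.span ℂ (Set.range ![B₀, C₀, Θ]) := fun a => by
    fin_cases a
    · exact hΘ𝔰
    · exact hB₀𝔰
    · exact hC₀𝔰
  have hops1 : ∀ a, ops 1 a ∈ W := fun a => by
    fin_cases a
    · exact hh'
    · exact he'
    · exact hf'
  have hops2 : ∀ a, ops 2 a ∈ ({h'', e'', f''} : Set (Module.End ℂ (ℂ ⊗[ℚ] V))) ∧ ops 2 a ∈ C := fun a => by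
    fin_cases a
    · exact ⟨Or.inl rfl, hh''⟩
    · exact ⟨Or.inr (Or.inl rfl), he''⟩
    · exact ⟨Or.inr (Or.inr rfl), hf''⟩
  have hops02 : ∀ a b, ops 0 a * ops 2 b = ops 2 b * ops 0 a := fun a b => by
    obtain ⟨h1, h2, h3⟩ := hZ' _ (hops2 b).1
    fin_cases a
    · exact h1.symm
    · exact h2.symm
    · exact h3.symm
  have hcomm_ops : ∀ i j, i ≠ j → ∀ a b, ops i a * ops j b = ops j b * ops i a := by
    intro i j hij a b
    fin_cases i <;> fin_cases j
    · exact absurd rfl hij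
    · exact (hW𝔰 _ (hops1 b) _ (hops0 a)).symm
    · exact hops02 a b
    · exact hW𝔰 _ (hops1 a) _ (hops0 b)
    · exact absurd rfl hij
    · exact hcommWC _ (hops1 a) _ (hops2 b).2
    · exact (hops02 b a).symm
    · exact (hcommWC _ (hops1 b) _ (hops2 a).2).symm
    · exact absurd rfl hij
  refine ⟨fun i => ops i 0, fun i => ops i 1, fun i => ops i 2, rfl, rfl, rfl, ?_, ?_, ?_, ?_⟩
  · intro i
    fin_cases i
    · exact ⟨hΘM, hB₀, Submodule.smul_mem _ _ hC₀M⟩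
    · exact ⟨hWle hh', hWle he', hWle hf'⟩
    · exact ⟨hCle hh'', hCle he'', hCle hf''⟩
  · intro i
    fin_cases i
    · exact ⟨hΘΘ1, hBB, hs3, hs1, hs2, hΘB1, hBΘ1, hs4, hs5⟩
    · exact ⟨hhh, hee, hff, hef, hfe, hhe, heh, hhf, hfh⟩
    · exact ⟨hhh', hee', hff', hef', hfe', hhe', heh', hhf', hfh'⟩
  · intro i j hij
    exact ⟨hcomm_ops i j hij 0 0, hcomm_ops i j hij 0 1, hcomm_ops i j hij 0 2, hcomm_ops i j hij 1 0,
      hcomm_ops i j hij 1 1, hcomm_ops i j hij 1 2, hcomm_ops i j hij 2 0, hcomm_ops i j hij 2 1, hcomm_ops i j hij 2 2⟩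
  · rw [hspan]
    refine le_antisymm ?_ ?_
    · rw [Submodule.span_le]
      rintro _ ⟨i, rfl⟩
      fin_cases i
      · exact Submodule.subset_span (Or.inl (Or.inl ⟨0, rfl⟩))
      · exact Submodule.subset_span (Or.inl (Or.inr ⟨0, rfl⟩))
      · -- `C₀ = μ₀ • (μ₀⁻¹ • C₀)`
        have h : C₀ = μ₀ • ops 0 2 := by
          change C₀ = μ₀ • (μ₀⁻¹ • C₀)
          rw [smul_smul, mul_inv_cancel₀ hμ₀, one_smul]
        change C₀ ∈ _
        rw [h]
        exact Submodule.smul_mem _ _ (Submodule.subset_span (Or.inr ⟨0, rfl⟩))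
      · exact Submodule.subset_span (Or.inl (Or.inl ⟨1, rfl⟩))
      · exact Submodule.subset_span (Or.inl (Or.inr ⟨1, rfl⟩))
      · exact Submodule.subset_span (Or.inr ⟨1, rfl⟩)
      · exact Submodule.subset_span (Or.inl (Or.inl ⟨2, rfl⟩))
      · exact Submodule.subset_span (Or.inl (Or.inr ⟨2, rfl⟩))
      · exact Submodule.subset_span (Or.inr ⟨2, rfl⟩)
    · rw [Submodule.span_le]
      rintro x ((⟨i, rfl⟩ | ⟨i, rfl⟩) | ⟨i, rfl⟩) <;> fin_cases i
      · exact Submodule.subset_span ⟨0, rfl⟩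
      · exact Submodule.subset_span ⟨3, rfl⟩
      · exact Submodule.subset_span ⟨6, rfl⟩
      · exact Submodule.subset_span ⟨1, rfl⟩
      · exact Submodule.subset_span ⟨4, rfl⟩
      · exact Submodule.subset_span ⟨7, rfl⟩
      · exact Submodule.smul_mem _ _ (Submodule.subset_span ⟨2, rfl⟩)
      · exact Submodule.subset_span ⟨5, rfl⟩
      · exact Submodule.subset_span ⟨8, rfl⟩

end HodgeStructure

end Literature.AlgebraicGeometry.Motives
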